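import Summits.AnomalousDissipation.AnomalousDissipation.Theorems.SawtoothPulseCascadeK1LocalisedCascadeClassBlocksCTGH
import Summits.AnomalousDissipation.AnomalousDissipation.Theorems.SawtoothPulseCascadeK1LocalisedCascadeStripBlocksCT

/-!
# K1loc — helper: THE STRIP (S-V) AND THE LOW FIBRES (T-H) OVER FIBRE BLOCKS IN ALL-ORDERS CORNER-TRACE GRADE («CT-GEO»; port of `…StripBlocksCTE`)

Helper file of the prover lane on the crux `K1LocalisedCascade` (stmt-AnomalousDissipation-19491), route `SawtoothPulseCascade`
(S-D fibre ledger, corner-trace track; finding F-p1g9-1, memo v15).  `…StripBlocksCTE.tsum_strip_vstep_blocks_ctE_le` /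
`tsum_lowFibre_hstep_blocks_ctE_le` re-run over `…ClassBlocksCTG{V,H}`: the strip `Σ'[|k₀| < K]‖𝓕a_{j+1}‖²` (fibres `k₁`, exact part
`|k₁| < Λ₀`) and the low fibres `Σ'[|k₁| < K]‖𝓕b_j‖²`, chopped fibres in blocks `[Λ_m, Λ_{m+1})`, box window `K`, box trapezoid
(plateau `L_m`, ramps `R_m`, `L_m + R_m ≥ 2`), `K + L_m + R_m < Λ_mG`; scalar bounds `A` (`Σ_m (1+ε)(N²/π²)τ_m r*_m`), `β*` (the
order-`p` remainder coefficient), `ρ*`, `Z` as hypotheses: `strip ≤ exact + ((√(A + β*/2) + √(ρ*/2 + Z) + √feed)² + tail²)`.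
No definitions; no statement about the crux. [cite: Grafakos2014, Prop. 3.1.2 (5), Prop. 3.2.7 (3)] [problem: turb]
-/

-- `Summit.<Summit>.<Problem>`: single-conjunct summit, the duplicate namespace segment is deliberate.
set_option linter.dupNamespace false

noncomputable section

namespace Summit.AnomalousDissipation.AnomalousDissipation.Theorems.SawtoothPulseCascade.K1Window

open MeasureTheory Set Filter Topology UnitAddTorus Function Complex Metric
open scoped Real ENNReal
open Literature.Analysis Literature.Analysis.FunctionSpaces Literature.Analysis.FunctionSpaces.Torus Literature.Analysis.FluidPDE
open Literature.Analysis.FluidPDE.ShearStage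
open Literature.Analysis.FluidPDE.SawtoothCascade Literature.Analysis.FluidPDE.SawtoothCascade.CascadeParams
open Summit.AnomalousDissipation.AnomalousDissipation.Theorems.SawtoothPulseCascade.K1Start
open Summit.AnomalousDissipation.AnomalousDissipation.Theorems.SawtoothPulseCascade.K1Flat
open Summit.AnomalousDissipation.AnomalousDissipation.Theorems.SawtoothPulseCascade.K1Ledger.From

section Cascade

variable (P : CascadeParams)

/-- **THE LOW STRIP OF `a_{j+1}` THROUGH THE V HALF-STEP, SUMMED OVER FIBRE BLOCKS, CT-GEO GRADE, AGGREGATE TRACKED ENERGY** (S-V; port of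
`…StripBlocksOsc.tsum_strip_vstep_blocks_osc_le`). [cite: Grafakos2014, Prop. 3.1.2 (5), Prop. 3.2.7 (3)] -/
theorem tsum_strip_vstep_blocks_ctg_le {G : ℕ} (hγ : P.γ = G) (hδ₀ : 0 < P.δ₀) (hd : 0 < P.d) (hN₀ : 1 ≤ P.N₀)
    (hρN : 1 ≤ P.ρN) (a b : ℕ → UnitAddTorus (Fin 2) → ℝ) (has : ∀ j, IsSmooth (a j)) (h0 : a 0 = datum)
    (hb : ∀ j, b j = a j ∘ shearMap 0 1 (amp ⟨P.U j, P.U_periodic j, P.contDiff_U (P.δ_pos hδ₀ hd j)⟩ P.γ))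
    (hab : ∀ j, a (j + 1) = b j ∘ shearMap 1 0 (amp ⟨P.U j, P.U_periodic j, P.contDiff_U (P.δ_pos hδ₀ hd j)⟩ P.γ))
    (j : ℕ) (K : ℕ) (Λb : ℕ → ℕ) (hΛb : Monotone Λb) (hΛ0 : 1 ≤ Λb 0) (Mb : ℕ)
    (L R : ℕ → ℕ) (hR : ∀ m, 0 < R m) (hLR : ∀ m, 2 ≤ L m + R m) (hΛQ : ∀ m, K + (L m + R m) < Λb m * G)
    {po : ℕ} (hp : 1 ≤ po) {εg : ℝ} (hεg : 0 < εg)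
    {M ε : ℝ} (hM : 1 ≤ M) (hMδ : M * P.δ j < π / 2) (hε : Real.exp (-(M ^ 2 / 2)) ≤ ε)
    {u' v' Y : ℕ} (hfeed : ∀ m, u' * Λb (m + 1) ≤ v' * (L m + 1)) (hY : ∀ m, Y ≤ L m + 1)
    {A βs ρs Z : ℝ} (hβs : 0 ≤ βs) (hρs : 0 ≤ ρs)
    (hA : ∑ m ∈ Finset.range Mb, (1 + εg) * ((P.N j : ℝ) ^ 2 / π ^ 2) *
              (8 * ((Λb m : ℝ) * G - (((L m + R m : ℕ) : ℝ) - 1)) ^ 2 / (((Λb m : ℝ) * G - (((L m + R m : ℕ) : ℝ) - 1)) ^ 2 - (K : ℝ) ^ 2) ^ 2 +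
                8 * ((K : ℝ) + 1 / 2) / (P.N j * (((Λb m : ℝ) * G - (((L m + R m : ℕ) : ℝ) - 1)) ^ 2 - ((K : ℝ) + 1 / 2) ^ 2))) *
              ((Real.sqrt ((2 * L m + R m : ℕ) * R m) / R m * 1) ^ 2 / 2 + (Real.sqrt ((2 * L m + R m : ℕ) * R m) / R m * 1) ^ 2 / 2) ≤ A)
    (hβ : ∀ m ∈ Finset.range Mb, (1 + εg⁻¹) * ((P.N j : ℝ) ^ 2 / π ^ 2) * (4 / (((Λb m * G - K - (L m + R m) : ℕ) : ℝ)) ^ 2 *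
              (1 / ((((Λb m * G - K - (L m + R m) : ℕ) : ℝ)) + ((L m + R m : ℕ) : ℝ)) ^ (2 * po) +
                1 / (P.N j * ((((Λb m * G - K - (L m + R m) : ℕ) : ℝ)) + ((L m + R m : ℕ) : ℝ)) ^ (2 * po - 1)))) *
              ((2 * ((L m + R m : ℕ) : ℝ) / P.N j + 1) * ((L m + R m : ℕ) : ℝ) ^ (2 * po)) ≤ βs)
    (hρ : ∀ m ∈ Finset.range Mb, (π * ((Λb (m + 1) * G : ℕ) : ℝ) * ε / P.N j) ^ 2 ≤ ρs)
    (hZ : ∑ m ∈ Finset.range Mb, 8 * M * P.δ j / π * ((Real.sqrt ((2 * L m + R m : ℕ) * R m) / R m * 1) ^ 2 / 2 +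
        (Real.sqrt ((2 * L m + R m : ℕ) * R m) / R m * 1) ^ 2 / 2) ≤ Z) :
    ∑' k : Fin 2 → ℤ, (if |k 0| < (K : ℤ) then (1 : ℝ) else 0) * ‖mFourierCoeff (fun x => (a (j + 1) x : ℂ)) k‖ ^ 2 ≤
      ∑' k : Fin 2 → ℤ, (if |k 1| < (Λb 0 : ℤ) then (1 : ℝ) else 0) * ‖mFourierCoeff (fun x => (b j x : ℂ)) k‖ ^ 2 +
      ((Real.sqrt (A + βs / 2) + Real.sqrt (ρs / 2 + Z) +
          Real.sqrt (∑' k : Fin 2 → ℤ, (if (Y : ℤ) ≤ |k 0| ∧ (u' : ℤ) * |k 1| ≤ (v' : ℤ) * |k 0| then (1 : ℝ) else 0) *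
            ‖mFourierCoeff (fun x => (b j x : ℂ)) k‖ ^ 2)) ^ 2 +
        ((1 + P.γ) ^ (2 * (j + 1)) / Λb Mb) ^ 2) := by
  classical
  set Ψ : ShearProfile := amp ⟨P.U j, P.U_periodic j, P.contDiff_U (P.δ_pos hδ₀ hd j)⟩ P.γ with hΨ
  have hbs : IsSmooth (b j) := isSmooth_b P hδ₀ hd a b has hb j
  have hac : Continuous fun x => (a (j + 1) x : ℂ) := by
    rw [hab j]; exact Complex.continuous_ofReal.comp (hbs.continuous.comp (continuous_shearMap 1 0 _))
  set c : (Fin 2 → ℤ) → ℝ := fun k => ‖mFourierCoeff (fun x => (a (j + 1) x : ℂ)) k‖ ^ 2 with hc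
  have hcs : Summable c := (hasSum_sq_mFourierCoeff_of_continuous hac).summable
  have hc0 : ∀ k, 0 ≤ c k := fun k => sq_nonneg _
  have hI : ∀ (r : (Fin 2 → ℤ) → Prop) [DecidablePred r], Summable fun k => (if r k then (1 : ℝ) else 0) * c k := by
    intro r _
    refine Summable.of_nonneg_of_le (fun k => mul_nonneg (by split_ifs <;> norm_num) (hc0 k)) (fun k => ?_) hcs
    exact mul_le_of_le_one_left (hc0 k) (by split_ifs <;> norm_num)
  -- the split off the low fibres
  have hsplit : ∑' k : Fin 2 → ℤ, (if |k 0| < (K : ℤ) then (1 : ℝ) else 0) * c k ≤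
      ∑' k : Fin 2 → ℤ, (if |k 1| < (Λb 0 : ℤ) then (1 : ℝ) else 0) * c k +
        ∑' k : Fin 2 → ℤ, (if |k 0| < (K : ℤ) ∧ (Λb 0 : ℤ) ≤ |k 1| then (1 : ℝ) else 0) * c k := by
    rw [← (hI _).tsum_add (hI _)]
    refine (hI _).tsum_le_tsum (fun k => ?_) ((hI _).add (hI _))
    rw [← add_mul]
    exact mul_le_mul_of_nonneg_right (strip_indicator_le_low_add (K : ℤ) (Λb 0 : ℤ) (k 0) (k 1)) (hc0 k)
  refine hsplit.trans (add_le_add ?_ ?_)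
  · -- low fibres pass through the V half-step exactly
    exact le_of_eq (tsum_verticalWeight_vstep (a' := a (j + 1)) hbs.continuous Ψ (hab j)
      (w := fun m : ℤ => if |m| < (Λb 0 : ℤ) then (1 : ℝ) else 0) (C := 1) (fun m => by split_ifs <;> norm_num))
  -- the chopped fibres, block by block
  set W : Finset (Fin 2 → ℤ) :=
    ((Finset.Icc (-(K : ℤ)) K ×ˢ Finset.Icc (-(Λb Mb : ℤ)) (Λb Mb)).filter
      (fun q : ℤ × ℤ => |q.1| < (K : ℤ) ∧ (Λb 0 : ℤ) ≤ |q.2| ∧ |q.2| < (Λb Mb : ℤ))).image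
      (fun q : ℤ × ℤ => (fun i : Fin 2 => if i = 0 then q.1 else q.2)) with hWdef
  have hWall : ∀ k ∈ W, |k 0| < (K : ℤ) ∧ (Λb 0 : ℤ) ≤ |k 1| ∧ |k 1| < (Λb Mb : ℤ) := by
    intro k hk
    obtain ⟨q, hq, rfl⟩ := Finset.mem_image.mp hk
    have h := (Finset.mem_filter.mp hq).2
    simpa using h
  have hqW : ∀ k : Fin 2 → ℤ, (|k 0| < (K : ℤ) ∧ (Λb 0 : ℤ) ≤ |k 1|) → |k 1| < (Λb Mb : ℤ) → k ∈ W := by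
    intro k hk h2
    refine Finset.mem_image.mpr ⟨(k 0, k 1), ?_, ?_⟩
    · refine Finset.mem_filter.mpr ⟨Finset.mem_product.mpr ⟨Finset.mem_Icc.mpr ?_, Finset.mem_Icc.mpr ?_⟩,
        hk.1, hk.2, h2⟩
      · exact ⟨by linarith [neg_abs_le (k 0), hk.1.le], by linarith [le_abs_self (k 0), hk.1.le]⟩
      · exact ⟨by linarith [neg_abs_le (k 1), h2.le], by linarith [le_abs_self (k 1), h2.le]⟩
    · funext i; fin_cases i <;> simp
  have hW : ∀ k ∈ W, (Λb 0 : ℤ) ≤ |k 1| ∧ |k 1| < (Λb Mb : ℤ) := fun k hk => ⟨(hWall k hk).2.1, (hWall k hk).2.2⟩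
  have hWK : ∀ m, ∀ k ∈ W, (Λb m : ℤ) ≤ |k 1| → |k 1| < (Λb (m + 1) : ℤ) → |k 0| ≤ (((fun _ : ℕ => K) m : ℕ) : ℤ) :=
    fun m k hk _ _ => (hWall k hk).1.le
  have hWsym : ∀ k ∈ W, Function.update k 1 (-k 1) ∈ W := by
    intro k hk
    obtain ⟨q, hq, rfl⟩ := Finset.mem_image.mp hk
    have h := Finset.mem_filter.mp hq
    simp only [Finset.mem_product, Finset.mem_Icc] at h
    obtain ⟨⟨⟨h1, h2⟩, h3, h4⟩, h5⟩ := h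
    refine Finset.mem_image.mpr ⟨(q.1, -q.2), ?_, ?_⟩
    · refine Finset.mem_filter.mpr ⟨Finset.mem_product.mpr ⟨Finset.mem_Icc.mpr ?_, Finset.mem_Icc.mpr ?_⟩, ?_⟩
      · exact ⟨h1, h2⟩
      · exact ⟨by omega, by omega⟩
      · simpa only [abs_neg] using h5
    · funext i; fin_cases i <;> simp
  have hPf : ∀ m, ∀ k : Fin 2 → ℤ, (Λb m : ℤ) ≤ |k 1| → |k 1| < (Λb (m + 1) : ℤ) → (L m : ℤ) < |k 0| →
      ((Y : ℤ) ≤ |k 0| ∧ (u' : ℤ) * |k 1| ≤ (v' : ℤ) * |k 0|) := by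
    intro m k _ h2 h3
    have hf : ((u' * Λb (m + 1) : ℕ) : ℤ) ≤ ((v' * (L m + 1) : ℕ) : ℤ) := by exact_mod_cast hfeed m
    have hYm : ((Y : ℕ) : ℤ) ≤ ((L m + 1 : ℕ) : ℤ) := by exact_mod_cast hY m
    push_cast at hf hYm
    have h3' : (L m : ℤ) + 1 ≤ |k 0| := h3
    refine ⟨by linarith, ?_⟩
    have hu'0 : (0 : ℤ) ≤ u' := by positivity
    have hv'0 : (0 : ℤ) ≤ v' := by positivity
    nlinarith [mul_le_mul_of_nonneg_left h2.le hu'0, mul_le_mul_of_nonneg_left h3' hv'0]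
  exact tsum_class_vstep_blocks_ctg_le P hγ hδ₀ hd hN₀ hρN a b has h0 hb hab j _ Λb hΛb hΛ0 Mb W hqW hW L R (fun _ : ℕ => K) hR hLR hWK
    (fun m _ => hΛQ m) hWsym hp hεg hM hMδ hε _ hPf hβs hρs hA hβ hρ hZ

/-- **THE LOW FIBRES OF `b_j` THROUGH THE H HALF-STEP, SUMMED OVER FIBRE BLOCKS, CT-GEO GRADE, AGGREGATE TRACKED ENERGY** (T-H; port of
`…StripBlocksOsc.tsum_lowFibre_hstep_blocks_osc_le`). [cite: Grafakos2014, Prop. 3.1.2 (5), Prop. 3.2.7 (3)] -/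
theorem tsum_lowFibre_hstep_blocks_ctg_le {G : ℕ} (hγ : P.γ = G) (hδ₀ : 0 < P.δ₀) (hd : 0 < P.d) (hN₀ : 1 ≤ P.N₀)
    (hρN : 1 ≤ P.ρN) (a b : ℕ → UnitAddTorus (Fin 2) → ℝ) (has : ∀ j, IsSmooth (a j)) (h0 : a 0 = datum)
    (hb : ∀ j, b j = a j ∘ shearMap 0 1 (amp ⟨P.U j, P.U_periodic j, P.contDiff_U (P.δ_pos hδ₀ hd j)⟩ P.γ))
    (hab : ∀ j, a (j + 1) = b j ∘ shearMap 1 0 (amp ⟨P.U j, P.U_periodic j, P.contDiff_U (P.δ_pos hδ₀ hd j)⟩ P.γ))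
    (j : ℕ) (K : ℕ) (Λb : ℕ → ℕ) (hΛb : Monotone Λb) (hΛ0 : 1 ≤ Λb 0) (Mb : ℕ)
    (L R : ℕ → ℕ) (hR : ∀ m, 0 < R m) (hLR : ∀ m, 2 ≤ L m + R m) (hΛQ : ∀ m, K + (L m + R m) < Λb m * G)
    {po : ℕ} (hp : 1 ≤ po) {εg : ℝ} (hεg : 0 < εg)
    {M ε : ℝ} (hM : 1 ≤ M) (hMδ : M * P.δ j < π / 2) (hε : Real.exp (-(M ^ 2 / 2)) ≤ ε)
    {u' v' : ℕ} (hfeed : ∀ m, u' * Λb (m + 1) ≤ v' * (L m + 1))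
    {A βs ρs Z : ℝ} (hβs : 0 ≤ βs) (hρs : 0 ≤ ρs)
    (hA : ∑ m ∈ Finset.range Mb, (1 + εg) * ((P.N j : ℝ) ^ 2 / π ^ 2) *
              (8 * ((Λb m : ℝ) * G - (((L m + R m : ℕ) : ℝ) - 1)) ^ 2 / (((Λb m : ℝ) * G - (((L m + R m : ℕ) : ℝ) - 1)) ^ 2 - (K : ℝ) ^ 2) ^ 2 +
                8 * ((K : ℝ) + 1 / 2) / (P.N j * (((Λb m : ℝ) * G - (((L m + R m : ℕ) : ℝ) - 1)) ^ 2 - ((K : ℝ) + 1 / 2) ^ 2))) *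
              ((Real.sqrt ((2 * L m + R m : ℕ) * R m) / R m * 1) ^ 2 / 2 + (Real.sqrt ((2 * L m + R m : ℕ) * R m) / R m * 1) ^ 2 / 2) ≤ A)
    (hβ : ∀ m ∈ Finset.range Mb, (1 + εg⁻¹) * ((P.N j : ℝ) ^ 2 / π ^ 2) * (4 / (((Λb m * G - K - (L m + R m) : ℕ) : ℝ)) ^ 2 *
              (1 / ((((Λb m * G - K - (L m + R m) : ℕ) : ℝ)) + ((L m + R m : ℕ) : ℝ)) ^ (2 * po) +
                1 / (P.N j * ((((Λb m * G - K - (L m + R m) : ℕ) : ℝ)) + ((L m + R m : ℕ) : ℝ)) ^ (2 * po - 1)))) *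
              ((2 * ((L m + R m : ℕ) : ℝ) / P.N j + 1) * ((L m + R m : ℕ) : ℝ) ^ (2 * po)) ≤ βs)
    (hρ : ∀ m ∈ Finset.range Mb, (π * ((Λb (m + 1) * G : ℕ) : ℝ) * ε / P.N j) ^ 2 ≤ ρs)
    (hZ : ∑ m ∈ Finset.range Mb, 8 * M * P.δ j / π * ((Real.sqrt ((2 * L m + R m : ℕ) * R m) / R m * 1) ^ 2 / 2 +
        (Real.sqrt ((2 * L m + R m : ℕ) * R m) / R m * 1) ^ 2 / 2) ≤ Z) :
    ∑' k : Fin 2 → ℤ, (if |k 1| < (K : ℤ) then (1 : ℝ) else 0) * ‖mFourierCoeff (fun x => (b j x : ℂ)) k‖ ^ 2 ≤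
      ∑' k : Fin 2 → ℤ, (if |k 0| < (Λb 0 : ℤ) then (1 : ℝ) else 0) * ‖mFourierCoeff (fun x => (a j x : ℂ)) k‖ ^ 2 +
      ((Real.sqrt (A + βs / 2) + Real.sqrt (ρs / 2 + Z) +
          Real.sqrt (∑' k : Fin 2 → ℤ, (if (Λb 0 : ℤ) ≤ |k 0| ∧ (u' : ℤ) * |k 0| ≤ (v' : ℤ) * |k 1| then (1 : ℝ) else 0) *
            ‖mFourierCoeff (fun x => (a j x : ℂ)) k‖ ^ 2)) ^ 2 +
        ((1 + P.γ) ^ (2 * j) / Λb Mb) ^ 2) := by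
  classical
  set Ψ : ShearProfile := amp ⟨P.U j, P.U_periodic j, P.contDiff_U (P.δ_pos hδ₀ hd j)⟩ P.γ with hΨ
  have hbs : IsSmooth (b j) := isSmooth_b P hδ₀ hd a b has hb j
  have hbc : Continuous fun x => (b j x : ℂ) := Complex.continuous_ofReal.comp hbs.continuous
  set c : (Fin 2 → ℤ) → ℝ := fun k => ‖mFourierCoeff (fun x => (b j x : ℂ)) k‖ ^ 2 with hc
  have hcs : Summable c := (hasSum_sq_mFourierCoeff_of_continuous hbc).summable
  have hc0 : ∀ k, 0 ≤ c k := fun k => sq_nonneg _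
  have hI : ∀ (r : (Fin 2 → ℤ) → Prop) [DecidablePred r], Summable fun k => (if r k then (1 : ℝ) else 0) * c k := by
    intro r _
    refine Summable.of_nonneg_of_le (fun k => mul_nonneg (by split_ifs <;> norm_num) (hc0 k)) (fun k => ?_) hcs
    exact mul_le_of_le_one_left (hc0 k) (by split_ifs <;> norm_num)
  have hsplit : ∑' k : Fin 2 → ℤ, (if |k 1| < (K : ℤ) then (1 : ℝ) else 0) * c k ≤
      ∑' k : Fin 2 → ℤ, (if |k 0| < (Λb 0 : ℤ) then (1 : ℝ) else 0) * c k +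
        ∑' k : Fin 2 → ℤ, (if |k 1| < (K : ℤ) ∧ (Λb 0 : ℤ) ≤ |k 0| then (1 : ℝ) else 0) * c k := by
    rw [← (hI _).tsum_add (hI _)]
    refine (hI _).tsum_le_tsum (fun k => ?_) ((hI _).add (hI _))
    rw [← add_mul]
    exact mul_le_mul_of_nonneg_right (strip_indicator_le_low_add (K : ℤ) (Λb 0 : ℤ) (k 1) (k 0)) (hc0 k)
  refine hsplit.trans (add_le_add ?_ ?_)
  · -- low `k₀`-fibres pass through the H half-step exactly
    exact le_of_eq (tsum_horizontalWeight_hstep (b := b j) (has j).continuous Ψ (hb j)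
      (w := fun m : ℤ => if |m| < (Λb 0 : ℤ) then (1 : ℝ) else 0) (C := 1) (fun m => by split_ifs <;> norm_num))
  set W : Finset (Fin 2 → ℤ) :=
    ((Finset.Icc (-(Λb Mb : ℤ)) (Λb Mb) ×ˢ Finset.Icc (-(K : ℤ)) K).filter
      (fun q : ℤ × ℤ => |q.2| < (K : ℤ) ∧ (Λb 0 : ℤ) ≤ |q.1| ∧ |q.1| < (Λb Mb : ℤ))).image
      (fun q : ℤ × ℤ => (fun i : Fin 2 => if i = 0 then q.1 else q.2)) with hWdef
  have hWall : ∀ k ∈ W, |k 1| < (K : ℤ) ∧ (Λb 0 : ℤ) ≤ |k 0| ∧ |k 0| < (Λb Mb : ℤ) := by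
    intro k hk
    obtain ⟨q, hq, rfl⟩ := Finset.mem_image.mp hk
    have h := (Finset.mem_filter.mp hq).2
    simpa using h
  have hqW : ∀ k : Fin 2 → ℤ, (|k 1| < (K : ℤ) ∧ (Λb 0 : ℤ) ≤ |k 0|) → |k 0| < (Λb Mb : ℤ) → k ∈ W := by
    intro k hk h2
    refine Finset.mem_image.mpr ⟨(k 0, k 1), ?_, ?_⟩
    · refine Finset.mem_filter.mpr ⟨Finset.mem_product.mpr ⟨Finset.mem_Icc.mpr ?_, Finset.mem_Icc.mpr ?_⟩,
        hk.1, hk.2, h2⟩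
      · exact ⟨by linarith [neg_abs_le (k 0), h2.le], by linarith [le_abs_self (k 0), h2.le]⟩
      · exact ⟨by linarith [neg_abs_le (k 1), hk.1.le], by linarith [le_abs_self (k 1), hk.1.le]⟩
    · funext i; fin_cases i <;> simp
  have hW : ∀ k ∈ W, (Λb 0 : ℤ) ≤ |k 0| ∧ |k 0| < (Λb Mb : ℤ) := fun k hk => ⟨(hWall k hk).2.1, (hWall k hk).2.2⟩
  have hWK : ∀ m, ∀ k ∈ W, (Λb m : ℤ) ≤ |k 0| → |k 0| < (Λb (m + 1) : ℤ) → |k 1| ≤ (((fun _ : ℕ => K) m : ℕ) : ℤ) :=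
    fun m k hk _ _ => (hWall k hk).1.le
  have hWsym : ∀ k ∈ W, Function.update k 0 (-k 0) ∈ W := by
    intro k hk
    obtain ⟨q, hq, rfl⟩ := Finset.mem_image.mp hk
    have h := Finset.mem_filter.mp hq
    simp only [Finset.mem_product, Finset.mem_Icc] at h
    obtain ⟨⟨⟨h1, h2⟩, h3, h4⟩, h5⟩ := h
    refine Finset.mem_image.mpr ⟨(-q.1, q.2), ?_, ?_⟩
    · refine Finset.mem_filter.mpr ⟨Finset.mem_product.mpr ⟨Finset.mem_Icc.mpr ?_, Finset.mem_Icc.mpr ?_⟩, ?_⟩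
      · exact ⟨by omega, by omega⟩
      · exact ⟨h3, h4⟩
      · simpa only [abs_neg] using h5
    · funext i; fin_cases i <;> simp
  have hPf : ∀ m, ∀ k : Fin 2 → ℤ, (Λb m : ℤ) ≤ |k 0| → |k 0| < (Λb (m + 1) : ℤ) → (L m : ℤ) < |k 1| →
      ((Λb 0 : ℤ) ≤ |k 0| ∧ (u' : ℤ) * |k 0| ≤ (v' : ℤ) * |k 1|) := by
    intro m k h1 h2 h3
    have hf : ((u' * Λb (m + 1) : ℕ) : ℤ) ≤ ((v' * (L m + 1) : ℕ) : ℤ) := by exact_mod_cast hfeed m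
    have hm0 : ((Λb 0 : ℕ) : ℤ) ≤ ((Λb m : ℕ) : ℤ) := by exact_mod_cast hΛb (Nat.zero_le m)
    push_cast at hf
    have h3' : (L m : ℤ) + 1 ≤ |k 1| := h3
    refine ⟨by linarith, ?_⟩
    have hu'0 : (0 : ℤ) ≤ u' := by positivity
    have hv'0 : (0 : ℤ) ≤ v' := by positivity
    nlinarith [mul_le_mul_of_nonneg_left h2.le hu'0, mul_le_mul_of_nonneg_left h3' hv'0]
  exact tsum_class_hstep_blocks_ctg_le P hγ hδ₀ hd hN₀ hρN a b has h0 hb hab j _ Λb hΛb hΛ0 Mb W hqW hW L R (fun _ : ℕ => K) hR hLR hWK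
    (fun m _ => hΛQ m) hWsym hp hεg hM hMδ hε _ hPf hβs hρs hA hβ hρ hZ

end Cascade

end Summit.AnomalousDissipation.AnomalousDissipation.Theorems.SawtoothPulseCascade.K1Window
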